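import Literature.Computability.QuantumComplexity.ForrelationThm25Sign
import Literature.Computability.QuantumComplexity.StabilizerSimulationProofs
import Literature.Computability.QuantumComplexity.CliffordSimulator
import Literature.Computability.QuantumComplexity.HadamardSandwich
import Literature.Computability.QuantumComplexity.CliffordTInverseCodeFP
import Literature.Computability.Complexity.FoldBricks
import Literature.Computability.Complexity.FPStringBricks
import Literature.Computability.Cryptography.QuantumCircuitDescFP
import HarnessLib

/-!
# QSIM over the sign basis reduces exactly to QSIM over `{H, CCSIGN}` (Aaronson–Ambainis, Lemma 24)

Topic `Literature/Computability/QuantumComplexity`. S. Aaronson, A. Ambainis, *Forrelation: a problem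
that optimally separates quantum from classical computing*, SIAM J. Comput. 47 (2018) = arXiv:1411.5729,
§6, p. 26, define QSIM for circuits `Q` over `{H, CCSIGN}` (`A_Q = ⟨0ⁿ|Q|0ⁿ⟩`, yes: `A_Q ≥ 3/5`, no:
`|A_Q| ≤ 1/100`) and state **Lemma 24** ("follows from Shi"): QSIM is `PromiseBQP`-complete. The tree
carries the hardness half twice: literally, `AaronsonAmbainis2018_lemma24_hard`
(`ForrelationCompleteProofs.lean`, problem `qSimProblem`), and over the *sign basis* `{H, Z, CZ, CCZ}`,
`AaronsonAmbainis2018_lemma24_sign_hard` (`QSimSign.lean`, problem `qSimSignProblem`), the intermediate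
problem through which Theorem 25 is proved (`AaronsonAmbainis2018_thm25_sign_holds`). This file proves
that the two hardness statements are equivalent in the useful direction:

* `qSimSign_polyTimeReducible_qSim` — **QSIM over `{H, Z, CZ, CCZ}` Karp-reduces in polynomial time to
  QSIM over `{H, CCSIGN}`**, by an *exact*, amplitude-preserving compilation;
* `AaronsonAmbainis2018_lemma24_hard_of_sign_hard` — hence `AaronsonAmbainis2018_lemma24_sign_hard →
  AaronsonAmbainis2018_lemma24_hard` (transitivity `PolyTimeReducible.trans_holds`).

## The mathematics: a constant `|1⟩` is exactly available over `{H, CCSIGN}`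

Over `{H, CCSIGN}` the gates `Z`, `CZ` are `CCSIGN` with one or two controls held at `|1⟩`; the only
question is whether a wire can be set to `|1⟩` *exactly* by Hadamards and `CCSIGN`s acting on `|0…0⟩`
(the module docstring of `QSimSign.lean` says it cannot; that remark is inaccurate — what does hold is
the weaker Toffoli–Hadamard obstruction: no operator with both entries `1` and `1/√2`, e.g. no
controlled-`H`, is a `{H, CCSIGN}` word).
**The 23-gate word** `QSimLift.gadgetOps` on three wires `q₀, q₁, q₂`,
`H₀ H₁ H₂ · V · C · V⁻¹ · H₂ H₀ H₁` with `C = CCSIGN` and `V = C H₀ C H₀ C H₁ C H₀` (time order),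
maps `|000⟩` to `|001⟩` exactly: `V` sends `|+++⟩` to the GHZ state `(|000⟩ + |111⟩)/√2`, on which `C`
acts as `Z_{q₂}`, and `V` commutes with `Z_{q₂}` (it has no Hadamard on `q₂`), so the word acts on `|000⟩`
as `H^{⊗3} Z_{q₂} H^{⊗3} = X_{q₂}`. (Found by exhaustive search over `{H, CCSIGN}` words; `21` gates is the
least number reaching a state with a wire identically `1`.) We certify the word twice applied on a
four-wire block (`QSimLift.prepOps`, targets `o₁ = 0` then `o₂ = 1`, helpers `2, 3`) by **computation
inside the kernel** (`QSimLift.run_prepOps`, `decide`): a small extension (`QSimLift.Sim`) of the tree's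
`ℤ[ω]` state-vector simulator `CliffordSim` (`CliffordSimulator.lean`) by the diagonal gate `CCSIGN`
(`Sim.negAll`), with its faithfulness theorem `Sim.toState_run`.

**The lift** of a sign-basis circuit `Q` on `n` wires is the `{H, CCSIGN}` circuit on `4 + n` wires
(ancillas first, data wire `w` on wire `4 + w`): preparation `P` of `|1100⟩` on the ancillas, the gates
of `Q` translated by `H ↦ H`, `CCZ ↦ CCSIGN` (shifted), `Z_a ↦ CCSIGN_{o₁ o₂ a}`, `CZ_{ab} ↦ CCSIGN_{o₁ a b}`
(`QSimLift.liftGate`), and the reversed word of `P`. Since all gates are real symmetric matrices the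
reversed word computes `Pᵀ`, whose row `⟨0…0|` is `⟨1100| ⊗ ⟨0ⁿ|`, and
**`⟨0^{4+n}| lift Q |0^{4+n}⟩ = ⟨0ⁿ| Q |0ⁿ⟩`** (`QSimLift.liftCircuit_toMatrix_apply_zero`,
`QSimLift.transitionAmplitude_liftCircuit`): yes/no instances go to yes/no instances with the thresholds
untouched (`QSimLift.isYes_liftInstance`, `QSimLift.isNo_liftInstance`).

**The code map** (Part II) `QSimLift.liftCodeFn : ⟨1ⁿ, code Q⟩ ↦ ⟨bin (4 + n), code (lift Q)⟩` is
assembled from the tree's polynomial-time bricks exactly as `InvCode.invCodeFn`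
(`CliffordTInverseCodeFP.lean`): a counted loop pops the gate codes one by one (`QSimLift.roundF`,
`iterate_mem_FP_of_growth`), rewrites each by a case distinction on its symbol numeral
(`QSimLift.tauF`: new symbol, new arity, wire numerals shifted by `addFn`, the constant numerals of
`o₁, o₂` spliced in) and appends it; the constant codes of the preparation are put around
(`QSimLift.liftCodeFn_mem_FP`, `QSimLift.liftCodeFn_encode`).

## Contents

* Part I (matrix level): `QSimLift.tripleEmb`; the simulator `QSimLift.Sim` (`negAll`, `GOp`, `run`,
  `toState_run`, `single`); the layout `one₁ one₂ dat`, `emb v = |1100⟩ ⊗ v`, `tensorVec_basisState`;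
  `liftGate` and `toMatrix_liftGate_mulVec_emb` (one translated gate acts on `|1100⟩ ⊗ v` as the original
  gate on `v`); `gadgetOps`, `prepOps`, `run_prepOps`, `prepCircuit_mulVec_zeroState`; `prepGates`
  (transport by the tree's `mapWiresGate`), `toMatrix_reverse_of_transpose`; `liftGates`, `liftCircuit`,
  `liftCircuit_toMatrix_apply_zero`, `transitionAmplitude_liftCircuit`; `liftInstance` with
  `isYes_liftInstance`, `isNo_liftInstance`.
* Part II (string level): the codes of the four sign-basis gates and of their lifts
  (`encode_sign_H/Z/CZ/CCZ`, `encode_liftGate_H/Z/CZ/CCZ`); the bricks `bodyF … tauF`, `roundF`,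
  `liftItemsFn`, `liftCodeFn` with membership in `FP` and growth bounds; the semantics `tauF_record`,
  `roundF_cons`, `iterate_roundF`, `liftItemsFn_encList`, `encode_liftCircuit`, `liftCodeFn_encode`;
  the reduction `qSimSign_polyTimeReducible_qSim` and `AaronsonAmbainis2018_lemma24_hard_of_sign_hard`.

Not here: the `PromiseBQP`-hardness of QSIM over the sign basis itself
(`AaronsonAmbainis2018_lemma24_sign_hard`, being discharged in the `Lemma24*.lean` files), after which
`AaronsonAmbainis2018_lemma24_hard_holds` is the one-line corollary of this file.

## References

* S. Aaronson, A. Ambainis, *Forrelation: a problem that optimally separates quantum from classical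
  computing*, SIAM J. Comput. 47 (2018) 982–1038; arXiv:1411.5729, §6, p. 26 (QSIM over `{H, CCSIGN}`,
  `A_Q`, Lemma 24 and its three-line proof: Shi's universality of `{H, Toffoli}`, uncomputing,
  `Q` and `-Q`).
* Y. Shi, *Both Toffoli and controlled-NOT need little help to do universal quantum computing*,
  Quantum Inf. Comput. 3 (2003) 84–92.
* M. Amy, A. N. Glaudell, N. J. Ross, *Number-theoretic characterizations of some restricted
  Clifford+T circuits*, Quantum 4 (2020) 252 (Toffoli–Hadamard circuits: all entries in one coset
  `√2^{-k} ℤ`, so no controlled-`H`; the gadget's states all have amplitudes in one such coset).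
* S. Arora, B. Barak, *Computational Complexity: A Modern Approach*, CUP 2009, §0.1 (pairing), §1.3
  (closure of polynomial time under composition and bounded loops), §6.1 (codes of circuits).
* M. A. Nielsen, I. L. Chuang, *Quantum Computation and Quantum Information*, CUP 2010, §2.1.7
  eq. (2.45) (`(A ⊗ B)(u ⊗ v)`), §4.2–4.3 (placement of gates).

## Design notes

* Ancillas in front (`Fin.castAdd`) and data behind (`Fin.natAdd 4`): the translated data gates are the
  tree's transports `mapWiresGate (Fin.natAddEmb 4)`, acting on the second tensor factor
  (`placeGate_natAddEmb_mulVec_tensorVec`), the preparation is `mapWires (Fin.castAddEmb n)` of a fixed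
  four-wire circuit acting on the first (`placeGate_castAddEmb_mulVec_tensorVec`); on codes the data
  wires are shifted by the constant `4` and the ancilla numerals are the constants `bin 0 … bin 3`, so the
  per-code rewriting needs no counting.
* Everything the kernel evaluates (`run_prepOps`) is first-order data (`CliffordSim.Vec` trees, lists of
  wire numbers); the complex semantics enters through `Vec.toState` only. The exact three-wire
  simulator `Lemma24.GSt` of `Lemma24Gadget.lean` (entries `(p + q√2)/2^k`, gates of `hSign`) is
  hard-wired to three wires; the preparation here lives on four wires over `hCCSign`, whence the
  extension of the `n`-qubit `CliffordSim.Vec` (amplitudes in `ℤ[ω] ⊇ ℤ`, `H` scaled by `√2`).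
* The code map is correct on the codes of oracle-free circuits (`liftCodeFn_encode`), which contain all
  yes- and no-instances; on other strings it is some polynomial-time junk, as a Karp reduction may be.
-/

noncomputable section

namespace Literature.Computability.QuantumComplexity

open Matrix _root_.Computability Complexity Cryptography Finset

namespace QSimLift

variable {N : ℕ}

/-! ### Three distinct wires as an embedding -/

/-- The embedding `Fin 3 ↪ Fin N` selecting three pairwise distinct wires `i, j, k` (in this
order). [folklore] -/
def tripleEmb (i j k : Fin N) (hij : i ≠ j) (hik : i ≠ k) (hjk : j ≠ k) : Fin 3 ↪ Fin N :=
  ⟨![i, j, k], by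
    intro a b hab
    fin_cases a <;> fin_cases b <;> simp_all [hij.symm, hik.symm, hjk.symm]⟩

/-- The first selected wire. [folklore] -/
@[simp] theorem tripleEmb_zero (i j k : Fin N) (hij : i ≠ j) (hik : i ≠ k) (hjk : j ≠ k) :
    tripleEmb i j k hij hik hjk 0 = i := rfl
/-- The second selected wire. [folklore] -/
@[simp] theorem tripleEmb_one (i j k : Fin N) (hij : i ≠ j) (hik : i ≠ k) (hjk : j ≠ k) :
    tripleEmb i j k hij hik hjk 1 = j := rfl
/-- The third selected wire. [folklore] -/
@[simp] theorem tripleEmb_two (i j k : Fin N) (hij : i ≠ j) (hik : i ≠ k) (hjk : j ≠ k) :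
    tripleEmb i j k hij hik hjk 2 = k := rfl

/-- `CCSIGN` is the diagonal `±1` gate flipping the sign of `|111⟩`. [folklore] -/
theorem ccsign_eq_diagonal :
    ccsign = Matrix.diagonal fun x : QReg 3 => if x 0 = true ∧ x 1 = true ∧ x 2 = true then -1 else 1 := rfl

/-- A placed `CCSIGN` is the diagonal `±1` operator flipping the sign where its three wires read `1`.
[folklore] -/
theorem placeGate_tripleEmb_ccsign (i j k : Fin N) (hij : i ≠ j) (hik : i ≠ k) (hjk : j ≠ k) :
    placeGate (tripleEmb i j k hij hik hjk) ccsign =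
      Matrix.diagonal fun x : QReg N => if x i = true ∧ x j = true ∧ x k = true then -1 else 1 := by
  rw [ccsign_eq_diagonal, placeGate_diagonal]
  rfl

/-! ### A kernel-executable simulator for words over `{H, CCSIGN}` -/

namespace Sim

open CliffordSim LightCone

variable {m : ℕ}

/-- Negate the amplitudes of all labels on which every wire of the list `ws` (wire numbers, as
naturals) reads `1`; wires `≥ m` make the condition unsatisfiable. First-order recursion on the
tree (for `decide`). [folklore] -/
def negAll : {m : ℕ} → List ℕ → Vec m → Vec m
  | 0, ws, .leaf a => if ws = [] then .leaf (-a) else .leaf a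
  | m + 1, ws, .node v₀ v₁ =>
    if m ∈ ws then .node v₀ (negAll (ws.filter (· ≠ m)) v₁)
    else .node (negAll ws v₀) (negAll ws v₁)

/-- The condition "every listed wire exists and reads `1`". [folklore] -/
def AllOnes (ws : List ℕ) (x : Fin m → Bool) : Prop := ∀ w ∈ ws, ∃ h : w < m, x ⟨w, h⟩ = true

/-- `AllOnes` is decidable. [folklore] -/
instance (ws : List ℕ) (x : Fin m → Bool) : Decidable (AllOnes ws x) := by
  unfold AllOnes; infer_instance

/-- **Pointwise semantics of `negAll`.** [folklore] -/
theorem eval_negAll : ∀ {m : ℕ} (ws : List ℕ) (v : Vec m) (x : Fin m → Bool),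
    (negAll ws v).eval x = if AllOnes ws x then -v.eval x else v.eval x
  | 0, ws, .leaf a, x => by
    by_cases hws : ws = []
    · subst hws
      have h1 : AllOnes ([] : List ℕ) x := fun w hw => by simp at hw
      rw [if_pos h1]
      rfl
    · have h1 : ¬ AllOnes ws x := fun h => by
        obtain ⟨w, hw⟩ := List.exists_mem_of_ne_nil ws hws
        obtain ⟨hlt, -⟩ := h w hw
        exact Nat.not_lt_zero w hlt
      rw [if_neg h1, show negAll ws (Vec.leaf a) = Vec.leaf a by simp [negAll, hws]]
  | m + 1, ws, .node v₀ v₁, x => by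
    by_cases hm : m ∈ ws
    · rw [show negAll ws (Vec.node v₀ v₁) = .node v₀ (negAll (ws.filter (· ≠ m)) v₁) by simp [negAll, hm],
        Vec.eval_node, Vec.eval_node, eval_negAll]
      cases hx : x (Fin.last m)
      · simp only [Bool.false_eq_true, if_false]
        rw [if_neg]
        rintro h
        obtain ⟨hlt, h1⟩ := h m hm
        have : (⟨m, hlt⟩ : Fin (m + 1)) = Fin.last m := rfl
        rw [this, hx] at h1
        exact Bool.false_ne_true h1
      · simp only [if_true]
        congr 1
        refine propext ⟨fun h w hw => ?_, fun h w hw => ?_⟩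
        · by_cases hwm : w = m
          · subst hwm
            exact ⟨Nat.lt_succ_self _, hx⟩
          · obtain ⟨hlt, h1⟩ := h w (List.mem_filter.2 ⟨hw, by simpa using hwm⟩)
            exact ⟨Nat.lt_succ_of_lt hlt, by simpa [Fin.init] using h1⟩
        · obtain ⟨hw', hwm⟩ := List.mem_filter.1 hw
          have hwm' : w ≠ m := by simpa using hwm
          obtain ⟨hlt, h1⟩ := h w hw'
          have hlt' : w < m := lt_of_le_of_ne (Nat.le_of_lt_succ hlt) hwm'
          exact ⟨hlt', by simpa [Fin.init] using h1⟩
    · rw [show negAll ws (Vec.node v₀ v₁) = .node (negAll ws v₀) (negAll ws v₁) by simp [negAll, hm],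
        Vec.eval_node, Vec.eval_node, eval_negAll, eval_negAll]
      have key : AllOnes ws (Fin.init x) ↔ AllOnes ws x := by
        refine ⟨fun h w hw => ?_, fun h w hw => ?_⟩
        · obtain ⟨hlt, h1⟩ := h w hw
          exact ⟨Nat.lt_succ_of_lt hlt, by simpa [Fin.init] using h1⟩
        · obtain ⟨hlt, h1⟩ := h w hw
          have hwm : w ≠ m := fun h' => hm (h' ▸ hw)
          have hlt' : w < m := lt_of_le_of_ne (Nat.le_of_lt_succ hlt) hwm
          exact ⟨hlt', by simpa [Fin.init] using h1⟩
      simp only [key]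
      split_ifs <;> rfl

/-- The gate symbols of the simulator: `H` on a wire, `CCSIGN` on three distinct wires. [folklore] -/
inductive GOp (m : ℕ)
  | H (k : Fin m)
  | CCZ (a b c : Fin m) (hab : a ≠ b) (hac : a ≠ c) (hbc : b ≠ c)

namespace GOp

/-- The tree's placed `{H, CCSIGN}` gate denoted by a symbol. [folklore] -/
def toGate : GOp m → QGate hCCSign m
  | H k => QGate.gate HCCSignOp.H (wireEmb k)
  | CCZ a b c hab hac hbc => QGate.gate HCCSignOp.CCSIGN (tripleEmb a b c hab hac hbc)

/-- The action of a symbol on trees (`H` scaled by `√2`). [folklore] -/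
def apply : GOp m → Vec m → Vec m
  | H k, v => v.applyH k
  | CCZ a b c _ _ _, v => negAll [a.val, b.val, c.val] v

/-- The scale of a symbol: `√2` for `H`, `1` for `CCSIGN`. [folklore] -/
def scale : GOp m → ℂ
  | H _ => ((Real.sqrt 2 : ℝ) : ℂ)
  | CCZ _ _ _ _ _ _ => 1

/-- Denoted gates are oracle-free. [folklore] -/
theorem toGate_isOracleFree (o : GOp m) : o.toGate.IsOracleFree := by
  cases o <;> trivial

/-- The matrix of a denoted `H` is the matrix of the Clifford+`T` symbol `H` on the same wire
(both are `placeGate (wireEmb k) hGate`). [folklore] -/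
theorem toMatrix_toGate_H (A : Language Bool) (k : Fin m) :
    (H k : GOp m).toGate.toMatrix A = (CliffordSim.Op.H k).toGate.toMatrix A := rfl

/-- **Faithfulness for one symbol**: the tree action is the (scaled) matrix action. [folklore] -/
theorem toState_apply (A : Language Bool) (o : GOp m) (v : Vec m) :
    (o.apply v).toState = o.scale • (o.toGate.toMatrix A *ᵥ v.toState) := by
  cases o with
  | H k =>
    rw [toMatrix_toGate_H]
    exact CliffordSim.Op.toState_apply A (CliffordSim.Op.H k) v
  | CCZ a b c hab hac hbc =>
    funext x
    rw [scale, one_smul, show (CCZ a b c hab hac hbc : GOp m).toGate.toMatrix A =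
      placeGate (tripleEmb a b c hab hac hbc) ccsign from rfl, placeGate_tripleEmb_ccsign,
      Matrix.mulVec_diagonal, Vec.toState_apply, apply, eval_negAll, Vec.toState_apply]
    have key : AllOnes [a.val, b.val, c.val] x ↔ (x a = true ∧ x b = true ∧ x c = true) := by
      simp only [AllOnes, List.mem_cons, List.not_mem_nil, or_false, forall_eq_or_imp, forall_eq,
        Fin.eta, Fin.is_lt, exists_true_left]
    simp only [key]
    split_ifs <;> simp

end GOp

/-- Run a word on a tree (head = first gate). [folklore] -/
def run : List (GOp m) → Vec m → Vec m
  | [], v => v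
  | o :: os, v => run os (o.apply v)

/-- The number of Hadamard symbols in a word. [folklore] -/
def countH : List (GOp m) → ℕ
  | [] => 0
  | GOp.H _ :: os => countH os + 1
  | GOp.CCZ _ _ _ _ _ _ :: os => countH os

/-- The gate list denoted by a word. [folklore] -/
def gates (ops : List (GOp m)) : List (QGate hCCSign m) := ops.map GOp.toGate

/-- The circuit denoted by a word. [folklore] -/
def circuit (ops : List (GOp m)) : QCircuit hCCSign m := ⟨gates ops⟩

/-- **Faithfulness of the simulator**: running a word computes `√2^{#H}` times the action of the
denoted circuit. [folklore] -/
theorem toState_run (A : Language Bool) : ∀ (ops : List (GOp m)) (v : Vec m),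
    (run ops v).toState = (((Real.sqrt 2 : ℝ) : ℂ) ^ countH ops) • ((circuit ops).toMatrix A *ᵥ v.toState)
  | [], v => by simp [run, countH, circuit, gates]
  | o :: os, v => by
    rw [run, toState_run A os (o.apply v), GOp.toState_apply A, Matrix.mulVec_smul, smul_smul,
      Matrix.mulVec_mulVec]
    have hc : circuit (o :: os) = ⟨o.toGate :: gates os⟩ := rfl
    rw [hc, QCircuit.toMatrix_cons]
    cases o <;> simp [countH, GOp.scale, circuit, pow_succ]

/-- The tree with amplitude `a` at the label `x₀` and `0` elsewhere. [folklore] -/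
def single : {m : ℕ} → (Fin m → Bool) → Amp → Vec m
  | 0, _, a => .leaf a
  | m + 1, x, a => if x (Fin.last m) then .node (Vec.zero m) (single (Fin.init x) a)
      else .node (single (Fin.init x) a) (Vec.zero m)

/-- Amplitudes of `single`. [folklore] -/
theorem eval_single : ∀ {m : ℕ} (x₀ : Fin m → Bool) (a : Amp) (x : Fin m → Bool),
    (single x₀ a).eval x = if x = x₀ then a else 0
  | 0, x₀, a, x => by rw [if_pos (Subsingleton.elim _ _)]; rfl
  | m + 1, x₀, a, x => by
    have hiff : x = x₀ ↔ x (Fin.last m) = x₀ (Fin.last m) ∧ Fin.init x = Fin.init x₀ := by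
      constructor
      · rintro rfl; exact ⟨rfl, rfl⟩
      · rintro ⟨hl, hi⟩
        rw [← Fin.snoc_init_self x, ← Fin.snoc_init_self x₀, hi, hl]
    unfold single
    cases h0 : x₀ (Fin.last m) <;> cases hx : x (Fin.last m) <;>
      simp only [Vec.eval_node, hx, if_true, Bool.false_eq_true, if_false, Vec.eval_zero,
        eval_single (Fin.init x₀) a (Fin.init x), hiff, h0, true_and, Bool.true_eq_false,
        Bool.false_eq_true, false_and, if_false]

/-- `toState` of `single x₀ a` is `a • |x₀⟩`. [folklore] -/
theorem toState_single (x₀ : Fin m → Bool) (a : Amp) :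
    (single x₀ a).toState = Amp.eval omega a • basisState x₀ := by
  funext x
  simp only [Vec.toState_apply, eval_single, Pi.smul_apply, basisState_apply, smul_eq_mul]
  split_ifs <;> simp

end Sim

/-! ### The register layout: four ancillas in front of the data wires -/

variable {n : ℕ}

/-- The first constant-`|1⟩` wire `o₁` (wire `0`). [folklore] -/
def one₁ (n : ℕ) : Fin (4 + n) := Fin.castAdd n 0

/-- The second constant-`|1⟩` wire `o₂` (wire `1`). [folklore] -/
def one₂ (n : ℕ) : Fin (4 + n) := Fin.castAdd n 1

/-- The data wire `w` of the simulated circuit sits on wire `4 + w`. [folklore] -/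
def dat (w : Fin n) : Fin (4 + n) := Fin.natAdd 4 w

/-- `o₁ ≠ o₂`. [folklore] -/
theorem one₁_ne_one₂ : one₁ n ≠ one₂ n := by
  simp [one₁, one₂, Fin.ext_iff]

/-- `o₁` is not a data wire. [folklore] -/
theorem one₁_ne_dat (w : Fin n) : one₁ n ≠ dat w := by
  intro h
  have := congrArg Fin.val h
  simp [one₁, dat] at this
  omega

/-- `o₂` is not a data wire. [folklore] -/
theorem one₂_ne_dat (w : Fin n) : one₂ n ≠ dat w := by
  intro h
  have := congrArg Fin.val h
  simp [one₂, dat] at this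
  omega

/-- Distinct data wires sit on distinct wires. [folklore] -/
theorem dat_ne_dat {v w : Fin n} (h : v ≠ w) : dat v ≠ dat w := by
  intro h'
  apply h
  have := congrArg Fin.val h'
  simp only [dat, Fin.val_natAdd] at this
  exact Fin.ext (by omega)

/-- The content `|1100⟩` of the four ancillas while the simulated circuit runs: `o₁ = o₂ = 1`,
the two helper wires back at `0`. [folklore] -/
def ancOnes : QReg 4 := ![true, true, false, false]

/-- `o₁` reads `1` in `|1100⟩`. [folklore] -/
@[simp] theorem ancOnes_zero : ancOnes 0 = true := rfl

/-- `o₂` reads `1` in `|1100⟩`. [folklore] -/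
@[simp] theorem ancOnes_one : ancOnes 1 = true := rfl

/-- The embedded state `|1100⟩ ⊗ v`. [folklore] -/
def emb (v : QReg n → ℂ) : QReg (4 + n) → ℂ := tensorVec (basisState ancOnes) v

/-- `|u⟩ ⊗ |w⟩ = |u w⟩`. [cite: NielsenChuang2010, §2.1.7] -/
theorem tensorVec_basisState {a b : ℕ} (u : QReg a) (w : QReg b) :
    tensorVec (basisState u) (basisState w) = basisState (Fin.append u w) := by
  funext z
  simp only [tensorVec_apply, basisState_apply]
  by_cases hz : z = Fin.append u w
  · subst hz
    rw [if_pos, if_pos, if_pos rfl, one_mul]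
    · funext j; exact Fin.append_right u w j
    · funext i; exact Fin.append_left u w i
  · rw [if_neg hz]
    by_cases h1 : (fun i => z (Fin.castAdd b i)) = u
    · rw [if_pos h1, one_mul, if_neg]
      intro h2
      exact hz (by rw [← Fin.append_castAdd_natAdd (f := z), h1, h2])
    · rw [if_neg h1, zero_mul]

/-- The embedding of a basis state is a basis state. [folklore] -/
theorem emb_basisState (w : QReg n) : emb (basisState w) = basisState (Fin.append ancOnes w) :=
  tensorVec_basisState ancOnes w

/-- A diagonal operator whose phase, on labels with ancilla content `|1100⟩`, is a phase of the
data part acts on embedded states through that phase. [folklore] -/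
theorem diagonal_mulVec_emb {D : QReg (4 + n) → ℂ} {d : QReg n → ℂ} (v : QReg n → ℂ)
    (h : ∀ x : QReg (4 + n), (fun i => x (Fin.castAdd n i)) = ancOnes →
      D x = d (fun j => x (Fin.natAdd 4 j))) :
    Matrix.diagonal D *ᵥ emb v = emb (Matrix.diagonal d *ᵥ v) := by
  funext x
  simp only [Matrix.mulVec_diagonal, emb, tensorVec_apply, basisState_apply]
  by_cases hx : (fun i => x (Fin.castAdd n i)) = ancOnes
  · rw [if_pos hx, h x hx]; ring
  · rw [if_neg hx]; simp

/-- On a label with ancilla content `|1100⟩` the wire `o₁` reads `1`. [folklore] -/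
theorem apply_one₁_of_anc {x : QReg (4 + n)} (hx : (fun i => x (Fin.castAdd n i)) = ancOnes) :
    x (one₁ n) = true :=
  congrFun hx 0

/-- On a label with ancilla content `|1100⟩` the wire `o₂` reads `1`. [folklore] -/
theorem apply_one₂_of_anc {x : QReg (4 + n)} (hx : (fun i => x (Fin.castAdd n i)) = ancOnes) :
    x (one₂ n) = true :=
  congrFun hx 1

/-! ### The translation of one gate -/

/-- `Z = diag(1, -1)`. [folklore] -/
theorem pauliZ_eq_diagonal :
    pauliZ = Matrix.diagonal fun z : QReg 1 => if z 0 = true then (-1 : ℂ) else 1 := by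
  ext x y
  by_cases h : x = y
  · subst h; simp [pauliZ]
  · rw [Matrix.diagonal_apply_ne _ h]; simp [pauliZ, h]

/-- `CZ = diag(1, 1, 1, -1)`. [folklore] -/
theorem cz_eq_diagonal :
    cz = Matrix.diagonal fun z : QReg 2 => if z 0 = true ∧ z 1 = true then (-1 : ℂ) else 1 := by
  ext x y
  by_cases h : x = y
  · subst h; simp [cz]
  · rw [Matrix.diagonal_apply_ne _ h]; simp [cz, h]

/-- The two wires of a `CZ` gate are distinct data wires. [folklore] -/
theorem signPlacementCZ_ne (e : Fin (hSign.arity HSignOp.CZ) ↪ Fin n) :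
    signPlacementCZ e 0 ≠ signPlacementCZ e 1 := fun h => by
  have := (signPlacementCZ e).injective h
  exact absurd this (by decide)

/-- **The gate translation.** `H` and `CCZ` (and, outside the promise, oracle gates) keep their
shape on the shifted data wires; `Z` on `a` becomes `CCSIGN` on `o₁, o₂, a`; `CZ` on `a, b`
becomes `CCSIGN` on `o₁, a, b`. [cite: AaronsonAmbainis2018, §6 (p. 26: QSIM over {H, CCSIGN})] -/
def liftGate : QGate hSign n → QGate hCCSign (4 + n)
  | .gate HSignOp.H e => QGate.gate HCCSignOp.H ((signPlacementH e).trans (Fin.natAddEmb 4))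
  | .gate HSignOp.Z e => QGate.gate HCCSignOp.CCSIGN
      (tripleEmb (one₁ n) (one₂ n) (dat (signPlacementZ e 0)) one₁_ne_one₂ (one₁_ne_dat _) (one₂_ne_dat _))
  | .gate HSignOp.CZ e => QGate.gate HCCSignOp.CCSIGN
      (tripleEmb (one₁ n) (dat (signPlacementCZ e 0)) (dat (signPlacementCZ e 1)) (one₁_ne_dat _)
        (one₁_ne_dat _) (dat_ne_dat (signPlacementCZ_ne e)))
  | .gate HSignOp.CCZ e => QGate.gate HCCSignOp.CCSIGN ((signPlacementCCZ e).trans (Fin.natAddEmb 4))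
  | .oracle k e => .oracle k (e.trans (Fin.natAddEmb 4))

/-- Translated gates of oracle-free gates are oracle-free. [folklore] -/
theorem isOracleFree_liftGate {g : QGate hSign n} (hg : g.IsOracleFree) : (liftGate g).IsOracleFree := by
  rcases g with ⟨g, e⟩ | ⟨k, e⟩
  · rcases g with _ | _ | _ | _ <;> trivial
  · exact absurd hg id

/-- **One translated gate acts on `|1100⟩ ⊗ v` as the original gate acts on `v`.**
[cite: AaronsonAmbainis2018, §6 (p. 26)] -/
theorem toMatrix_liftGate_mulVec_emb (A : Language Bool) (g : QGate hSign n) (v : QReg n → ℂ) :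
    (liftGate g).toMatrix A *ᵥ emb v = emb (g.toMatrix A *ᵥ v) := by
  rcases g with ⟨g, e⟩ | ⟨k, e⟩
  · rcases g with _ | _ | _ | _
    · -- `H`: the gate transported to the data wires
      change (mapWiresGate (Fin.natAddEmb 4) (QGate.gate HSignOp.H e : QGate hSign n)).toMatrix A *ᵥ emb v = _
      rw [toMatrix_mapWiresGate, emb, placeGate_natAddEmb_mulVec_tensorVec]
      rfl
    · -- `Z` on `a` is `CCSIGN` on `o₁, o₂, a`
      change placeGate (tripleEmb (one₁ n) (one₂ n) (dat (signPlacementZ e 0)) one₁_ne_one₂ (one₁_ne_dat _)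
        (one₂_ne_dat _)) ccsign *ᵥ emb v = emb (placeGate (signPlacementZ e) pauliZ *ᵥ v)
      rw [placeGate_tripleEmb_ccsign, pauliZ_eq_diagonal, placeGate_diagonal]
      refine diagonal_mulVec_emb v fun x hx => ?_
      simp only [apply_one₁_of_anc hx, apply_one₂_of_anc hx, true_and, Function.comp_apply]
      rfl
    · -- `CZ` on `a, b` is `CCSIGN` on `o₁, a, b`
      change placeGate (tripleEmb (one₁ n) (dat (signPlacementCZ e 0)) (dat (signPlacementCZ e 1)) (one₁_ne_dat _)
        (one₁_ne_dat _) (dat_ne_dat (signPlacementCZ_ne e))) ccsign *ᵥ emb v =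
        emb (placeGate (signPlacementCZ e) cz *ᵥ v)
      rw [placeGate_tripleEmb_ccsign, cz_eq_diagonal, placeGate_diagonal]
      refine diagonal_mulVec_emb v fun x hx => ?_
      simp only [apply_one₁_of_anc hx, true_and, Function.comp_apply]
      rfl
    · -- `CCZ`: transported
      change (mapWiresGate (Fin.natAddEmb 4) (QGate.gate HSignOp.CCZ e : QGate hSign n)).toMatrix A *ᵥ emb v = _
      rw [toMatrix_mapWiresGate, emb, placeGate_natAddEmb_mulVec_tensorVec]
      rfl
  · -- oracle gates: transported
    change (mapWiresGate (Fin.natAddEmb 4) (QGate.oracle k e : QGate hSign n)).toMatrix A *ᵥ emb v = _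
    rw [toMatrix_mapWiresGate, emb, placeGate_natAddEmb_mulVec_tensorVec]
    rfl

/-- **The translated gate list acts on `|1100⟩ ⊗ v` as the original list acts on `v`.**
[cite: AaronsonAmbainis2018, §6 (p. 26)] -/
theorem toMatrix_map_liftGate_mulVec_emb (A : Language Bool) :
    ∀ (gs : List (QGate hSign n)) (v : QReg n → ℂ),
      (⟨gs.map liftGate⟩ : QCircuit hCCSign (4 + n)).toMatrix A *ᵥ emb v =
        emb ((⟨gs⟩ : QCircuit hSign n).toMatrix A *ᵥ v)
  | [], v => by simp
  | g :: gs, v => by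
    rw [List.map_cons, QCircuit.toMatrix_cons, QCircuit.toMatrix_cons, ← Matrix.mulVec_mulVec,
      ← Matrix.mulVec_mulVec, toMatrix_liftGate_mulVec_emb, toMatrix_map_liftGate_mulVec_emb A gs]

/-! ### The constant-`|1⟩` gadget and the preparation of the ancillas -/

/-- **The 23-gate gadget** on three distinct wires `q₀, q₁` (helpers) and `q₂` (target), time
order: `H H H · (C H₀ C H₀ C H₁ C H₀) · C · (H₀ C H₁ C H₀ C H₀ C) · H₂ H₀ H₁` with `C` the `CCSIGN` on
the three wires. Started on `|000⟩` it ends in `|001⟩` exactly: the inner word `V = C H₀ C H₀ C H₁ C H₀`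
maps `|+++⟩` to the GHZ state `(|000⟩ + |111⟩)/√2`, on which `C` acts as `Z` on `q₂`; `V` commutes
with that `Z`, so the whole word is `H^{⊗3} Z_{q₂} H^{⊗3} = X_{q₂}` on `|000⟩`. (Found by exhaustive
search; it is a shortest `{H, CCSIGN}` word moving `|000⟩` to a basis state with a `1`.) [folklore] -/
def gadgetOps {m : ℕ} (q₀ q₁ q₂ : Fin m) (h₀₁ : q₀ ≠ q₁) (h₀₂ : q₀ ≠ q₂) (h₁₂ : q₁ ≠ q₂) : List (Sim.GOp m) :=
  [.H q₀, .H q₁, .H q₂,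
   .CCZ q₀ q₁ q₂ h₀₁ h₀₂ h₁₂, .H q₀, .CCZ q₀ q₁ q₂ h₀₁ h₀₂ h₁₂, .H q₀, .CCZ q₀ q₁ q₂ h₀₁ h₀₂ h₁₂, .H q₁,
   .CCZ q₀ q₁ q₂ h₀₁ h₀₂ h₁₂, .H q₀,
   .CCZ q₀ q₁ q₂ h₀₁ h₀₂ h₁₂,
   .H q₀, .CCZ q₀ q₁ q₂ h₀₁ h₀₂ h₁₂, .H q₁, .CCZ q₀ q₁ q₂ h₀₁ h₀₂ h₁₂, .H q₀, .CCZ q₀ q₁ q₂ h₀₁ h₀₂ h₁₂, .H q₀,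
   .CCZ q₀ q₁ q₂ h₀₁ h₀₂ h₁₂,
   .H q₂, .H q₀, .H q₁]

/-- **The preparation word** on the four ancillas (`o₁ = 0`, `o₂ = 1`, helpers `2, 3`): the gadget
with target `o₁`, then the gadget with target `o₂` (the helpers are back at `0` in between). [folklore] -/
def prepOps : List (Sim.GOp 4) :=
  gadgetOps 2 3 0 (by decide) (by decide) (by decide) ++ gadgetOps 2 3 1 (by decide) (by decide) (by decide)

/-- **The preparation word maps `|0000⟩` to `2^{14} · |1100⟩` in the scaled arithmetic** (it has
`28` Hadamards), decided by the kernel. [folklore] -/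
theorem run_prepOps :
    Sim.run prepOps (CliffordSim.Vec.vac 4) = Sim.single ancOnes ⟨16384, 0, 0, 0⟩ := by
  decide +kernel

/-- The preparation word has `28` Hadamards. [folklore] -/
theorem countH_prepOps : Sim.countH prepOps = 28 := by decide

/-- `√2 ^ 28 = 16384`. [folklore] -/
theorem sqrt_two_pow_twentyEight : ((Real.sqrt 2 : ℝ) : ℂ) ^ 28 = 16384 := by
  rw [show 28 = 2 * 14 from rfl, pow_mul, sqrt_two_sq_complex]
  norm_num

/-- **The preparation circuit maps `|0000⟩` to `|1100⟩`.** [folklore] -/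
theorem prepCircuit_mulVec_zeroState (A : Language Bool) :
    (Sim.circuit prepOps).toMatrix A *ᵥ zeroState 4 = basisState ancOnes := by
  have key := congrArg CliffordSim.Vec.toState run_prepOps
  rw [Sim.toState_run A, CliffordSim.Vec.toState_vac, Sim.toState_single, countH_prepOps,
    sqrt_two_pow_twentyEight] at key
  have he : LightCone.Amp.eval omega ⟨16384, 0, 0, 0⟩ = (16384 : ℂ) := by
    simp [LightCone.Amp.eval]
  rw [he] at key
  exact smul_right_injective _ (by norm_num : (16384 : ℂ) ≠ 0) key

/-- The preparation gates on the full register (the ancillas are its first four wires). [folklore] -/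
def prepGates (n : ℕ) : List (QGate hCCSign (4 + n)) :=
  (Sim.gates prepOps).map (mapWiresGate (Fin.castAddEmb n))

/-- The preparation circuit on the full register is the four-wire circuit placed in front. [folklore] -/
theorem toMatrix_prepGates (A : Language Bool) :
    (⟨prepGates n⟩ : QCircuit hCCSign (4 + n)).toMatrix A =
      placeGate (Fin.castAddEmb n) ((Sim.circuit prepOps).toMatrix A) :=
  toMatrix_mapWires (Fin.castAddEmb n) A (Sim.circuit prepOps)

/-- **The preparation maps `|0^{4+n}⟩` to `|1100⟩ ⊗ |0ⁿ⟩`.** [folklore] -/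
theorem prepGates_mulVec_zeroState (A : Language Bool) :
    (⟨prepGates n⟩ : QCircuit hCCSign (4 + n)).toMatrix A *ᵥ zeroState (4 + n) = emb (zeroState n) := by
  rw [toMatrix_prepGates, ← tensorVec_zeroState, placeGate_castAddEmb_mulVec_tensorVec,
    prepCircuit_mulVec_zeroState]
  rfl

/-- All preparation gates are oracle-free. [folklore] -/
theorem isOracleFree_of_mem_prepGates {g : QGate hCCSign (4 + n)} (hg : g ∈ prepGates n) : g.IsOracleFree := by
  obtain ⟨g', hg', rfl⟩ := List.mem_map.1 hg
  obtain ⟨o, -, rfl⟩ := List.mem_map.1 hg'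
  exact isOracleFree_mapWiresGate _ (Sim.GOp.toGate_isOracleFree o)

/-! ### Undoing the preparation: the reversed word is the transpose -/

/-- The matrices of the simulator's gates are symmetric (`H` is symmetric, `CCSIGN` diagonal). [folklore] -/
theorem transpose_toMatrix_toGate {m : ℕ} (A : Language Bool) (o : Sim.GOp m) :
    (o.toGate.toMatrix A)ᵀ = o.toGate.toMatrix A := by
  cases o with
  | H k =>
    change (placeGate (wireEmb k) hGate)ᵀ = placeGate (wireEmb k) hGate
    rw [placeGate_transpose, hGate_transpose]
  | CCZ a b c h₁ h₂ h₃ =>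
    change (placeGate (tripleEmb a b c h₁ h₂ h₃) ccsign)ᵀ = placeGate (tripleEmb a b c h₁ h₂ h₃) ccsign
    rw [placeGate_transpose, ccsign_eq_diagonal, Matrix.diagonal_transpose]

/-- The matrices of the preparation gates are symmetric. [folklore] -/
theorem transpose_toMatrix_of_mem_prepGates (A : Language Bool) {g : QGate hCCSign (4 + n)}
    (hg : g ∈ prepGates n) : (g.toMatrix A)ᵀ = g.toMatrix A := by
  obtain ⟨g', hg', rfl⟩ := List.mem_map.1 hg
  obtain ⟨o, -, rfl⟩ := List.mem_map.1 hg'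
  rw [toMatrix_mapWiresGate, placeGate_transpose, transpose_toMatrix_toGate]

/-- **A reversed list of symmetric gates computes the transpose.** [folklore] -/
theorem toMatrix_reverse_of_transpose {G : QGateSet} {m : ℕ} (A : Language Bool) (gs : List (QGate G m))
    (h : ∀ g ∈ gs, (g.toMatrix A)ᵀ = g.toMatrix A) :
    (⟨gs.reverse⟩ : QCircuit G m).toMatrix A = ((⟨gs⟩ : QCircuit G m).toMatrix A)ᵀ := by
  simp only [QCircuit.toMatrix, List.map_reverse, List.reverse_reverse, Matrix.transpose_list_prod,
    List.map_map]
  congr 1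
  exact List.map_congr_left fun g hg => (h g hg).symm

/-! ### The lifted circuit and its transition amplitude -/

/-- **The lift of a sign-basis gate list to `{H, CCSIGN}` on `4 + n` wires**: prepare the two
constant-`|1⟩` wires, run the translated gates, undo the preparation (the reversed word).
[cite: AaronsonAmbainis2018, §6 (p. 26)] -/
def liftGates (gs : List (QGate hSign n)) : List (QGate hCCSign (4 + n)) :=
  prepGates n ++ gs.map liftGate ++ (prepGates n).reverse

/-- The lift of a circuit. [cite: AaronsonAmbainis2018, §6 (p. 26)] -/
def liftCircuit (Q : QCircuit hSign n) : QCircuit hCCSign (4 + n) := ⟨liftGates Q.gates⟩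

/-- The lift of an oracle-free circuit is oracle-free. [folklore] -/
theorem isOracleFree_liftCircuit {Q : QCircuit hSign n} (hQ : Q.IsOracleFree) : (liftCircuit Q).IsOracleFree := by
  intro g hg
  simp only [liftCircuit, liftGates, List.mem_append, List.mem_map, List.mem_reverse] at hg
  rcases hg with (hg | ⟨g', hg', rfl⟩) | hg
  · exact isOracleFree_of_mem_prepGates hg
  · exact isOracleFree_liftGate (hQ g' hg')
  · exact isOracleFree_of_mem_prepGates hg

/-- **The lift preserves the transition amplitude exactly**:
`⟨0^{4+n}| lift Q |0^{4+n}⟩ = ⟨0ⁿ| Q |0ⁿ⟩`. Proof: the preparation sends `|0…0⟩` to `|1100⟩ ⊗ |0ⁿ⟩`,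
the translated gates act there as `Q` on the data factor, and the reversed preparation word is the
transpose of the preparation, whose row `⟨0…0|` is `⟨1100| ⊗ ⟨0ⁿ|`. [cite: AaronsonAmbainis2018, §6 (p. 26)] -/
theorem liftCircuit_toMatrix_apply_zero (A : Language Bool) (Q : QCircuit hSign n) :
    (liftCircuit Q).toMatrix A (fun _ => false) (fun _ => false) = Q.toMatrix A (fun _ => false) (fun _ => false) := by
  obtain ⟨gs⟩ := Q
  set P : QCircuit hCCSign (4 + n) := ⟨prepGates n⟩ with hPdef
  set B : QCircuit hCCSign (4 + n) := ⟨gs.map liftGate⟩ with hBdef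
  set R : QCircuit hCCSign (4 + n) := ⟨(prepGates n).reverse⟩ with hRdef
  have hdec : liftCircuit ⟨gs⟩ = (P.append B).append R := rfl
  have hR : R.toMatrix A = (P.toMatrix A)ᵀ :=
    toMatrix_reverse_of_transpose A _ fun g hg => transpose_toMatrix_of_mem_prepGates A hg
  set z₁ : QReg (4 + n) := Fin.append ancOnes (fun _ : Fin n => false) with hz₁
  have hP : ∀ y, P.toMatrix A y (fun _ => false) = basisState z₁ y := fun y => by
    have h := congrFun (prepGates_mulVec_zeroState (n := n) A) y
    simp only [zeroState, mulVec_basisState, emb_basisState] at h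
    exact h
  have hBP : (B.toMatrix A * P.toMatrix A) z₁ (fun _ => false) =
      ((⟨gs⟩ : QCircuit hSign n).toMatrix A) (fun _ => false) (fun _ => false) := by
    have h2 : (B.toMatrix A * P.toMatrix A) *ᵥ zeroState (4 + n) =
        emb (((⟨gs⟩ : QCircuit hSign n).toMatrix A) *ᵥ zeroState n) := by
      rw [← Matrix.mulVec_mulVec, prepGates_mulVec_zeroState, toMatrix_map_liftGate_mulVec_emb]
    have h3 := congrFun h2 z₁
    simp only [zeroState, mulVec_basisState] at h3
    rw [h3, emb, tensorVec_apply, basisState_apply, if_pos]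
    · rw [one_mul]
      show ((⟨gs⟩ : QCircuit hSign n).toMatrix A) (fun j => z₁ (Fin.natAdd 4 j)) (fun _ => false) = _
      congr 1
      funext j
      exact Fin.append_right ancOnes (fun _ : Fin n => false) j
    · funext i
      exact Fin.append_left ancOnes (fun _ : Fin n => false) i
  rw [hdec, QCircuit.toMatrix_append, QCircuit.toMatrix_append, Matrix.mul_apply]
  simp only [hR, Matrix.transpose_apply, hP, basisState_apply]
  simp only [ite_mul, one_mul, zero_mul, Finset.sum_ite_eq', Finset.mem_univ, if_true]
  exact hBP

/-- **The lift preserves `A_Q`**: `A_{lift Q} = A_Q`. [cite: AaronsonAmbainis2018, §6 (p. 26)] -/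
theorem transitionAmplitude_liftCircuit (Q : QCircuit hSign n) :
    transitionAmplitude (liftCircuit Q) = signAmplitude Q := by
  unfold transitionAmplitude signAmplitude QCircuit.mat
  rw [liftCircuit_toMatrix_apply_zero]

/-! ### The instance map -/

/-- **The instance map of the reduction**: an instance `(n, Q)` of QSIM over the sign basis goes to
the instance `(4 + n, lift Q)` of QSIM over `{H, CCSIGN}`. [cite: AaronsonAmbainis2018, §6 (p. 26)] -/
def liftInstance (I : QSimSignInstance) : QSimInstance :=
  ⟨4 + I.n, liftCircuit I.circuit⟩

/-- The amplitude is preserved. [cite: AaronsonAmbainis2018, §6 (p. 26)] -/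
theorem amplitude_liftInstance (I : QSimSignInstance) : (liftInstance I).amplitude = I.amplitude :=
  transitionAmplitude_liftCircuit I.circuit

/-- **Yes-instances go to yes-instances.** [cite: AaronsonAmbainis2018, §6 (p. 26)] -/
theorem isYes_liftInstance {I : QSimSignInstance} (h : I.IsYes) : (liftInstance I).IsYes :=
  ⟨isOracleFree_liftCircuit h.1, by rw [amplitude_liftInstance]; exact h.2⟩

/-- **No-instances go to no-instances.** [cite: AaronsonAmbainis2018, §6 (p. 26)] -/
theorem isNo_liftInstance {I : QSimSignInstance} (h : I.IsNo) : (liftInstance I).IsNo :=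
  ⟨isOracleFree_liftCircuit h.1, by rw [amplitude_liftInstance]; exact h.2⟩

/-! ## Part II: the code map is polynomial time -/

section CodeMap

open Complexity.Brick Complexity.Plumb Polynomial



/-! ### Codes of the lifted gates -/

/-- `bin 4 = [0, 0, 1]`. [folklore] -/
theorem encodeNat_four : encodeNat 4 = [false, false, true] := by decide

/-- The symbol numeral of the sign-basis `H`: `bin 0 = []`. [folklore] -/
theorem encodeNat_encode_signH : encodeNat (Encodable.encode (HSignOp.H : hSign.Op)) = [] := by decide
/-- The symbol numeral of the sign-basis `Z`: `bin 1`. [folklore] -/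
theorem encodeNat_encode_signZ : encodeNat (Encodable.encode (HSignOp.Z : hSign.Op)) = [true] := by decide
/-- The symbol numeral of the sign-basis `CZ`: `bin 2`. [folklore] -/
theorem encodeNat_encode_signCZ : encodeNat (Encodable.encode (HSignOp.CZ : hSign.Op)) = [false, true] := by decide
/-- The symbol numeral of the sign-basis `CCZ`: `bin 3`. [folklore] -/
theorem encodeNat_encode_signCCZ : encodeNat (Encodable.encode (HSignOp.CCZ : hSign.Op)) = [true, true] := by decide
/-- The symbol numeral of `H ∈ {H, CCSIGN}`: `bin 0 = []`. [folklore] -/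
theorem encodeNat_encode_hccH : encodeNat (Encodable.encode (HCCSignOp.H : hCCSign.Op)) = [] := by decide
/-- The symbol numeral of `CCSIGN`: `bin 1`. [folklore] -/
theorem encodeNat_encode_hccCCSIGN : encodeNat (Encodable.encode (HCCSignOp.CCSIGN : hCCSign.Op)) = [true] := by decide

/-- The wire-list code of a list of naturals: unary length, then the pair list of the numerals.
[cite: AroraBarak2009, §0.1] -/
theorem encodingListNatBool_encode (ws : List ℕ) :
    encodingListNatBool.encode ws = boolPair (unaryEncodeNat ws.length) (encList (ws.map encodeNat)) := by
  change boolPair (unaryEncodeNat ws.length) (ws.foldr (fun a acc => boolPair (encodeNat a) acc) []) = _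
  congr 1
  induction ws with
  | nil => rfl
  | cons w ws ih => rw [List.foldr_cons, ih, List.map_cons, encList_cons]

/-- `List.ofFn` on `Fin 1`. [folklore] -/
theorem ofFn_fin_one {α : Type*} (f : Fin 1 → α) : List.ofFn f = [f 0] := by
  simp [List.ofFn_succ]

/-- `List.ofFn` on `Fin 2`. [folklore] -/
theorem ofFn_fin_two {α : Type*} (f : Fin 2 → α) : List.ofFn f = [f 0, f 1] := by
  simp [List.ofFn_succ]

/-- `List.ofFn` on `Fin 3`. [folklore] -/
theorem ofFn_fin_three {α : Type*} (f : Fin 3 → α) : List.ofFn f = [f 0, f 1, f 2] := by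
  simp [List.ofFn_succ]

/-- The value of a shifted data wire. [folklore] -/
@[simp] theorem val_dat (w : Fin n) : (dat w : ℕ) = 4 + w := rfl

/-- The value of `o₁`. [folklore] -/
@[simp] theorem val_one₁ : (one₁ n : ℕ) = 0 := rfl

/-- The value of `o₂`. [folklore] -/
@[simp] theorem val_one₂ : (one₂ n : ℕ) = 1 := rfl

/-- **Code of a sign-basis `H` gate.** [cite: AroraBarak2009, §6.1] -/
theorem encode_sign_H (e : Fin (hSign.arity HSignOp.H) ↪ Fin n) :
    (QGate.gate HSignOp.H e : QGate hSign n).encode =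
      false :: boolPair [] (boolPair [true] (encList [encodeNat (signPlacementH e 0)])) := by
  show false :: boolPair (encodeNat (Encodable.encode (HSignOp.H : hSign.Op)))
    (encodingListNatBool.encode (List.ofFn fun i => ((signPlacementH e) i : ℕ))) = _
  rw [encodeNat_encode_signH, ofFn_fin_one, encodingListNatBool_encode]
  rfl

/-- **Code of a sign-basis `Z` gate.** [cite: AroraBarak2009, §6.1] -/
theorem encode_sign_Z (e : Fin (hSign.arity HSignOp.Z) ↪ Fin n) :
    (QGate.gate HSignOp.Z e : QGate hSign n).encode =
      false :: boolPair [true] (boolPair [true] (encList [encodeNat (signPlacementZ e 0)])) := by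
  show false :: boolPair (encodeNat (Encodable.encode (HSignOp.Z : hSign.Op)))
    (encodingListNatBool.encode (List.ofFn fun i => ((signPlacementZ e) i : ℕ))) = _
  rw [encodeNat_encode_signZ, ofFn_fin_one, encodingListNatBool_encode]
  rfl

/-- **Code of a sign-basis `CZ` gate.** [cite: AroraBarak2009, §6.1] -/
theorem encode_sign_CZ (e : Fin (hSign.arity HSignOp.CZ) ↪ Fin n) :
    (QGate.gate HSignOp.CZ e : QGate hSign n).encode =
      false :: boolPair [false, true] (boolPair [true, true]
        (encList [encodeNat (signPlacementCZ e 0), encodeNat (signPlacementCZ e 1)])) := by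
  show false :: boolPair (encodeNat (Encodable.encode (HSignOp.CZ : hSign.Op)))
    (encodingListNatBool.encode (List.ofFn fun i => ((signPlacementCZ e) i : ℕ))) = _
  rw [encodeNat_encode_signCZ, ofFn_fin_two, encodingListNatBool_encode]
  rfl

/-- **Code of a sign-basis `CCZ` gate.** [cite: AroraBarak2009, §6.1] -/
theorem encode_sign_CCZ (e : Fin (hSign.arity HSignOp.CCZ) ↪ Fin n) :
    (QGate.gate HSignOp.CCZ e : QGate hSign n).encode =
      false :: boolPair [true, true] (boolPair [true, true, true]
        (encList [encodeNat (signPlacementCCZ e 0), encodeNat (signPlacementCCZ e 1), encodeNat (signPlacementCCZ e 2)])) := by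
  show false :: boolPair (encodeNat (Encodable.encode (HSignOp.CCZ : hSign.Op)))
    (encodingListNatBool.encode (List.ofFn fun i => ((signPlacementCCZ e) i : ℕ))) = _
  rw [encodeNat_encode_signCCZ, ofFn_fin_three, encodingListNatBool_encode]
  rfl

/-- Wire values of a placement shifted to the data wires. [folklore] -/
theorem ofFn_val_trans_natAddEmb {k : ℕ} (e : Fin k ↪ Fin n) :
    (List.ofFn fun i => (((e.trans (Fin.natAddEmb 4)) i : Fin (4 + n)) : ℕ)) = List.ofFn fun i => (e i : ℕ) + 4 := by
  congr 1
  funext i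
  simp [Nat.add_comm]

/-- **Code of the lift of an `H` gate.** [cite: AroraBarak2009, §6.1] -/
theorem encode_liftGate_H (e : Fin (hSign.arity HSignOp.H) ↪ Fin n) :
    (liftGate (QGate.gate HSignOp.H e : QGate hSign n)).encode =
      false :: boolPair [] (boolPair [true] (encList [encodeNat ((signPlacementH e 0 : ℕ) + 4)])) := by
  show false :: boolPair (encodeNat (Encodable.encode (HCCSignOp.H : hCCSign.Op)))
    (encodingListNatBool.encode (List.ofFn fun i => ((((signPlacementH e).trans (Fin.natAddEmb 4)) i : Fin (4 + n)) : ℕ))) = _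
  rw [encodeNat_encode_hccH, ofFn_val_trans_natAddEmb, ofFn_fin_one, encodingListNatBool_encode]
  rfl

/-- **Code of the lift of a `Z` gate.** [cite: AroraBarak2009, §6.1] -/
theorem encode_liftGate_Z (e : Fin (hSign.arity HSignOp.Z) ↪ Fin n) :
    (liftGate (QGate.gate HSignOp.Z e : QGate hSign n)).encode =
      false :: boolPair [true] (boolPair [true, true, true]
        (encList [[], [true], encodeNat ((signPlacementZ e 0 : ℕ) + 4)])) := by
  show false :: boolPair (encodeNat (Encodable.encode (HCCSignOp.CCSIGN : hCCSign.Op)))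
    (encodingListNatBool.encode (List.ofFn fun i => ((tripleEmb (one₁ n) (one₂ n) (dat (signPlacementZ e 0))
      one₁_ne_one₂ (one₁_ne_dat _) (one₂_ne_dat _) i : Fin (4 + n)) : ℕ))) = _
  rw [encodeNat_encode_hccCCSIGN, ofFn_fin_three, encodingListNatBool_encode]
  simp only [tripleEmb_zero, tripleEmb_one, tripleEmb_two, val_one₁, val_one₂, val_dat, List.map, List.length,
    Nat.add_comm 4]
  rfl

/-- **Code of the lift of a `CZ` gate.** [cite: AroraBarak2009, §6.1] -/
theorem encode_liftGate_CZ (e : Fin (hSign.arity HSignOp.CZ) ↪ Fin n) :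
    (liftGate (QGate.gate HSignOp.CZ e : QGate hSign n)).encode =
      false :: boolPair [true] (boolPair [true, true, true]
        (encList [[], encodeNat ((signPlacementCZ e 0 : ℕ) + 4), encodeNat ((signPlacementCZ e 1 : ℕ) + 4)])) := by
  show false :: boolPair (encodeNat (Encodable.encode (HCCSignOp.CCSIGN : hCCSign.Op)))
    (encodingListNatBool.encode (List.ofFn fun i => ((tripleEmb (one₁ n) (dat (signPlacementCZ e 0))
      (dat (signPlacementCZ e 1)) (one₁_ne_dat _) (one₁_ne_dat _) (dat_ne_dat (signPlacementCZ_ne e)) i : Fin (4 + n)) : ℕ))) = _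
  rw [encodeNat_encode_hccCCSIGN, ofFn_fin_three, encodingListNatBool_encode]
  simp only [tripleEmb_zero, tripleEmb_one, tripleEmb_two, val_one₁, val_dat, List.map, List.length, Nat.add_comm 4]
  rfl

/-- **Code of the lift of a `CCZ` gate.** [cite: AroraBarak2009, §6.1] -/
theorem encode_liftGate_CCZ (e : Fin (hSign.arity HSignOp.CCZ) ↪ Fin n) :
    (liftGate (QGate.gate HSignOp.CCZ e : QGate hSign n)).encode =
      false :: boolPair [true] (boolPair [true, true, true]
        (encList [encodeNat ((signPlacementCCZ e 0 : ℕ) + 4), encodeNat ((signPlacementCCZ e 1 : ℕ) + 4),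
          encodeNat ((signPlacementCCZ e 2 : ℕ) + 4)])) := by
  show false :: boolPair (encodeNat (Encodable.encode (HCCSignOp.CCSIGN : hCCSign.Op)))
    (encodingListNatBool.encode (List.ofFn fun i => ((((signPlacementCCZ e).trans (Fin.natAddEmb 4)) i : Fin (4 + n)) : ℕ))) = _
  rw [encodeNat_encode_hccCCSIGN, ofFn_val_trans_natAddEmb, ofFn_fin_three, encodingListNatBool_encode]
  rfl

/-! ### The per-code transformation, assembled from the polynomial-time bricks -/

/-- The popped code behind its tag bit: the record `⟨symbol numeral, ⟨unary arity, wire numerals⟩⟩`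
(the popped code itself is `InvCode.itemF`). [folklore] -/
def bodyF : List Bool → List Bool := dropFn ∘ fanoutFn (fun _ => [true]) InvCode.itemF

/-- The pair list of the wire numerals of the popped code. [folklore] -/
def wiresF : List Bool → List Bool := sndF ∘ sndF ∘ bodyF

/-- The `i`-th wire numeral of the popped code, shifted by `4` (`bin (w + 4)`). [folklore] -/
def shF (i : ℕ) : List Bool → List Bool := addFn ∘ fanoutFn (nthF i ∘ wiresF) (fun _ => encodeNat 4)

/-- Test: the symbol numeral of the popped code is `v`. [folklore] -/
def isSymF (v : List Bool) : List Bool → List Bool := eqPairFn ∘ fanoutFn InvCode.symF fun _ => v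

/-- The new code for a popped `H` code: `H` on the shifted wire. [folklore] -/
def outH : List Bool → List Bool :=
  List.cons false ∘ fanoutFn (fun _ => []) (fanoutFn (fun _ => [true]) (fanoutFn (shF 0) fun _ => []))

/-- The new code for a popped `Z` code: `CCSIGN` on `o₁, o₂` and the shifted wire. [folklore] -/
def outZ : List Bool → List Bool :=
  List.cons false ∘ fanoutFn (fun _ => [true]) (fanoutFn (fun _ => [true, true, true])
    (fanoutFn (fun _ => []) (fanoutFn (fun _ => [true]) (fanoutFn (shF 0) fun _ => []))))

/-- The new code for a popped `CZ` code: `CCSIGN` on `o₁` and the two shifted wires. [folklore] -/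
def outCZ : List Bool → List Bool :=
  List.cons false ∘ fanoutFn (fun _ => [true]) (fanoutFn (fun _ => [true, true, true])
    (fanoutFn (fun _ => []) (fanoutFn (shF 0) (fanoutFn (shF 1) fun _ => []))))

/-- The new code for a popped `CCZ` code: `CCSIGN` on the three shifted wires. [folklore] -/
def outCCZ : List Bool → List Bool :=
  List.cons false ∘ fanoutFn (fun _ => [true]) (fanoutFn (fun _ => [true, true, true])
    (fanoutFn (shF 0) (fanoutFn (shF 1) (fanoutFn (shF 2) fun _ => []))))

/-- **The new code of the popped code**, by case distinction on its symbol numeral. [folklore] -/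
def tauF : List Bool → List Bool :=
  iteFn (isSymF []) outH (iteFn (isSymF [true]) outZ (iteFn (isSymF [false, true]) outCZ outCCZ))

/-- The new accumulator: the new code appended as a last item. [folklore] -/
def newAccF (z : List Bool) : List Bool := sndPow 1 z ++ fanoutFn tauF (fun _ => []) z

/-- **One round** on records `⟨x, ⟨rest, acc⟩⟩`: idle if `rest = []`, else pop the first code of
`rest` and append its new code to `acc`. [folklore] -/
def roundF : List Bool → List Bool :=
  iteFn (isNilFn ∘ nthF 1) (fanoutFn (nthF 0) (fanoutFn (nthF 1) (sndPow 1)))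
    (fanoutFn (nthF 0) (fanoutFn (sndF ∘ nthF 1) newAccF))

/-- **The transformation of a pair list of gate codes**: `|s|` rounds from `⟨s, ⟨s, []⟩⟩`
(`InvCode.initF`), then the accumulator. [folklore] -/
def liftItemsFn : List Bool → List Bool :=
  sndPow 1 ∘ (fun z => roundF^[(X : ℕ[X]).eval (boolUnpair z).1.length] z) ∘ InvCode.initF

/-- The codes of the preparation gates (they do not depend on the number of data wires). [folklore] -/
def prepCodes : List (List Bool) := (Sim.gates prepOps).map QGate.encode

/-- **The code map of the reduction**: `⟨1ⁿ, code Q⟩ ↦ ⟨bin (n + 4), code (lift Q)⟩`, the code of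
the lift being the codes of the preparation, the transformed codes, and the codes of the reversed
preparation. [cite: AaronsonAmbainis2018, §6 (p. 26)] -/
def liftCodeFn : List Bool → List Bool :=
  fanoutFn (addFn ∘ fanoutFn (lenBinF ∘ fstF) fun _ => encodeNat 4)
    fun s => encList prepCodes ++ (liftItemsFn (sndF s) ++ encList prepCodes.reverse)

/-! ### Membership in `FP` -/

/-- `bodyF ∈ FP`. [folklore] -/
theorem bodyF_mem_FP : bodyF ∈ FP :=
  comp_mem_FP dropFn_mem_FP (fanoutFn_mem_FP (const_mem_FP _) InvCode.itemF_mem_FP)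

/-- `wiresF ∈ FP`. [folklore] -/
theorem wiresF_mem_FP : wiresF ∈ FP := comp_mem_FP sndF_mem_FP (comp_mem_FP sndF_mem_FP bodyF_mem_FP)

/-- `shF i ∈ FP`. [folklore] -/
theorem shF_mem_FP (i : ℕ) : shF i ∈ FP :=
  comp_mem_FP addFn_mem_FP (fanoutFn_mem_FP (comp_mem_FP (nthF_mem_FP i) wiresF_mem_FP) (const_mem_FP _))

/-- `isSymF v ∈ FP`. [folklore] -/
theorem isSymF_mem_FP (v : List Bool) : isSymF v ∈ FP :=
  comp_mem_FP eqPairFn_mem_FP (fanoutFn_mem_FP InvCode.symF_mem_FP (const_mem_FP _))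

/-- `outH ∈ FP`. [folklore] -/
theorem outH_mem_FP : outH ∈ FP :=
  comp_mem_FP (cons_mem_FP false) (fanoutFn_mem_FP (const_mem_FP _) (fanoutFn_mem_FP (const_mem_FP _)
    (fanoutFn_mem_FP (shF_mem_FP 0) (const_mem_FP _))))

/-- `outZ ∈ FP`. [folklore] -/
theorem outZ_mem_FP : outZ ∈ FP :=
  comp_mem_FP (cons_mem_FP false) (fanoutFn_mem_FP (const_mem_FP _) (fanoutFn_mem_FP (const_mem_FP _)
    (fanoutFn_mem_FP (const_mem_FP _) (fanoutFn_mem_FP (const_mem_FP _) (fanoutFn_mem_FP (shF_mem_FP 0) (const_mem_FP _))))))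

/-- `outCZ ∈ FP`. [folklore] -/
theorem outCZ_mem_FP : outCZ ∈ FP :=
  comp_mem_FP (cons_mem_FP false) (fanoutFn_mem_FP (const_mem_FP _) (fanoutFn_mem_FP (const_mem_FP _)
    (fanoutFn_mem_FP (const_mem_FP _) (fanoutFn_mem_FP (shF_mem_FP 0) (fanoutFn_mem_FP (shF_mem_FP 1) (const_mem_FP _))))))

/-- `outCCZ ∈ FP`. [folklore] -/
theorem outCCZ_mem_FP : outCCZ ∈ FP :=
  comp_mem_FP (cons_mem_FP false) (fanoutFn_mem_FP (const_mem_FP _) (fanoutFn_mem_FP (const_mem_FP _)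
    (fanoutFn_mem_FP (shF_mem_FP 0) (fanoutFn_mem_FP (shF_mem_FP 1) (fanoutFn_mem_FP (shF_mem_FP 2) (const_mem_FP _))))))

/-- `tauF ∈ FP`. [folklore] -/
theorem tauF_mem_FP : tauF ∈ FP :=
  iteFn_mem_FP (isSymF_mem_FP _) outH_mem_FP
    (iteFn_mem_FP (isSymF_mem_FP _) outZ_mem_FP (iteFn_mem_FP (isSymF_mem_FP _) outCZ_mem_FP outCCZ_mem_FP))

/-- `newAccF ∈ FP`. [folklore] -/
theorem newAccF_mem_FP : newAccF ∈ FP :=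
  append_mem_FP (sndPow_mem_FP 1) (fanoutFn_mem_FP tauF_mem_FP (const_mem_FP _))

/-- `roundF ∈ FP`. [folklore] -/
theorem roundF_mem_FP : roundF ∈ FP :=
  iteFn_mem_FP (comp_mem_FP isNilFn_mem_FP (nthF_mem_FP 1))
    (fanoutFn_mem_FP (nthF_mem_FP 0) (fanoutFn_mem_FP (nthF_mem_FP 1) (sndPow_mem_FP 1)))
    (fanoutFn_mem_FP (nthF_mem_FP 0) (fanoutFn_mem_FP (comp_mem_FP sndF_mem_FP (nthF_mem_FP 1)) newAccF_mem_FP))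

/-! ### Growth of the round -/

/-- The symbol tests are one-bit. [folklore] -/
theorem oneBit_isSymF (v : List Bool) : OneBit (isSymF v) := fun z => by
  rcases eqPairFn_eq_or (fanoutFn InvCode.symF (fun _ => v) z) with h | h
  · exact ⟨true, h⟩
  · exact ⟨false, h⟩

/-- The body of the popped code is no longer than the input field. [folklore] -/
theorem length_bodyF_le (z : List Bool) : (bodyF z).length ≤ (fstF z).length := by
  have h := InvCode.length_itemF_le z
  simp only [bodyF, Function.comp_apply, fanoutFn_apply, dropFn_boolPair, List.length_singleton, List.length_drop]
  omega

/-- The wire list of the popped code is no longer than the input field. [folklore] -/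
theorem length_wiresF_le (z : List Bool) : (wiresF z).length ≤ (fstF z).length := by
  have h := length_bodyF_le z
  have h1 := length_fstF_sndF_le (bodyF z)
  have h2 := length_fstF_sndF_le (sndF (bodyF z))
  simp only [wiresF, Function.comp_apply]
  omega

/-- A shifted wire numeral is at most four symbols longer than the input field. [folklore] -/
theorem length_shF_le (i : ℕ) (z : List Bool) : (shF i z).length ≤ (fstF z).length + 4 := by
  have h := length_addFn_le (fanoutFn (nthF i ∘ wiresF) (fun _ => encodeNat 4) z)
  simp only [fanoutFn_apply, fstF_boolPair, sndF_boolPair, Function.comp_apply] at h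
  have h1 := length_nthF_le i (wiresF z)
  have h2 := length_wiresF_le z
  have h4 : (encodeNat 4).length = 3 := by rw [encodeNat_four]; rfl
  simp only [shF, Function.comp_apply, fanoutFn_apply]
  omega

/-- **The new code is short**: `|tauF z| ≤ 6 |x| + 43`. [folklore] -/
theorem length_tauF_le (z : List Bool) : (tauF z).length ≤ 6 * (fstF z).length + 43 := by
  have h0 := length_shF_le 0 z
  have h1 := length_shF_le 1 z
  have h2 := length_shF_le 2 z
  rw [tauF, iteFn_of_oneBit (oneBit_isSymF _)]
  split_ifs
  · simp only [outH, Function.comp_apply, List.length_cons, length_fanoutFn, List.length_nil]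
    omega
  · rw [iteFn_of_oneBit (oneBit_isSymF _)]
    split_ifs
    · simp only [outZ, Function.comp_apply, List.length_cons, length_fanoutFn, List.length_nil]
      omega
    · rw [iteFn_of_oneBit (oneBit_isSymF _)]
      split_ifs
      · simp only [outCZ, Function.comp_apply, List.length_cons, length_fanoutFn, List.length_nil]
        omega
      · simp only [outCCZ, Function.comp_apply, List.length_cons, length_fanoutFn, List.length_nil]
        omega

/-- The round is an honest case distinction. [folklore] -/
theorem roundF_apply (z : List Bool) :
    roundF z = if (isNilFn ∘ nthF 1) z = [true] then fanoutFn (nthF 0) (fanoutFn (nthF 1) (sndPow 1)) z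
      else fanoutFn (nthF 0) (fanoutFn (sndF ∘ nthF 1) newAccF) z :=
  iteFn_of_oneBit (oneBit_isNilFn.comp _) _ _ z

/-- **The round keeps the input field.** [folklore] -/
theorem fstF_roundF (z : List Bool) : fstF (roundF z) = fstF z := by
  rw [roundF_apply]
  split_ifs <;> simp

/-- **Linear growth of the round** in the input field. [folklore] -/
theorem length_roundF_le (z : List Bool) : (roundF z).length ≤ z.length + 92 * ((fstF z).length + 1) := by
  have hf := InvCode.length_fields_le z
  rw [roundF_apply]
  split_ifs
  · rw [length_fanoutFn, length_fanoutFn]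
    simp only [nthF_zero]
    omega
  · rw [length_fanoutFn, length_fanoutFn]
    simp only [nthF_zero, Function.comp_apply, newAccF, List.length_append, length_fanoutFn, List.length_nil]
    have hn := length_tauF_le z
    have hs : (sndF (nthF 1 z)).length ≤ (nthF 1 z).length := by
      have := length_fstF_sndF_le (nthF 1 z); omega
    omega

/-- **`liftItemsFn ∈ FP`.** [cite: AroraBarak2009, §1.3, Remark 6.7] -/
theorem liftItemsFn_mem_FP : liftItemsFn ∈ FP :=
  comp_mem_FP (sndPow_mem_FP 1) (comp_mem_FP
    (iterate_mem_FP_of_growth roundF_mem_FP 92 fstF_roundF length_roundF_le X) InvCode.initF_mem_FP)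

/-- **`liftCodeFn ∈ FP`.** [cite: AroraBarak2009, §1.3, Remark 6.7] -/
theorem liftCodeFn_mem_FP : liftCodeFn ∈ FP := by
  have h1 : (liftItemsFn ∘ sndF) ∈ FP := comp_mem_FP liftItemsFn_mem_FP sndF_mem_FP
  have h2 : (fun s => (liftItemsFn ∘ sndF) s ++ (fun _ => encList prepCodes.reverse) s) ∈ FP :=
    append_mem_FP h1 (const_mem_FP _)
  have h3 : (fun s => (fun _ => encList prepCodes) s ++
      (fun s => (liftItemsFn ∘ sndF) s ++ (fun _ => encList prepCodes.reverse) s) s) ∈ FP :=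
    append_mem_FP (const_mem_FP _) h2
  exact fanoutFn_mem_FP
    (comp_mem_FP addFn_mem_FP (fanoutFn_mem_FP (comp_mem_FP lenBinF_mem_FP fstF_mem_FP) (const_mem_FP _))) h3

/-! ### Semantics of the round -/

/-- `bin` shifted: `bin (⟦bin w⟧ + ⟦bin 4⟧) = bin (w + 4)`. [folklore] -/
theorem encodeNat_bitsToNat_add_four (w : ℕ) :
    encodeNat (bitsToNat (encodeNat w) + bitsToNat (encodeNat 4)) = encodeNat (w + 4) := by
  rw [bitsToNat_encodeNat, bitsToNat_encodeNat]

/-- Fields of the empty record are empty. [folklore] -/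
theorem nthF_nil : ∀ i : ℕ, nthF i ([] : List Bool) = []
  | 0 => rfl
  | i + 1 => by rw [nthF, Function.comp_apply, show sndF ([] : List Bool) = [] from rfl, nthF_nil i]

/-- The `i`-th numeral of a pair list of numerals has the value of the `i`-th number (`0` beyond the
end). [folklore] -/
theorem bitsToNat_nthF_encList_map : ∀ (ws : List ℕ) (i : ℕ),
    bitsToNat (nthF i (encList (ws.map encodeNat))) = ws.getD i 0
  | [], i => by rw [List.map_nil, encList_nil, nthF_nil]; rfl
  | w :: ws, 0 => by simp [encList_cons]
  | w :: ws, i + 1 => by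
    rw [List.map_cons, encList_cons, nthF_succ_boolPair, bitsToNat_nthF_encList_map ws i]
    rfl

/-- **The bricks on a record whose first remaining code is a proper gate code**: the values of
`tauF` on `⟨x, ⟨⟨tag · ⟨sym, ⟨un, wires⟩⟩, rest⟩, acc⟩⟩`. [folklore] -/
theorem tauF_record (x acc un : List Bool) (sym : List Bool) (tag : Bool) (ws : List ℕ) (l : List (List Bool))
    (ha : (tag :: boolPair sym (boolPair un (encList (ws.map encodeNat)))).length ≤ x.length) :
    tauF (boolPair x (boolPair (encList ((tag :: boolPair sym (boolPair un (encList (ws.map encodeNat)))) :: l)) acc)) =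
      if sym = [] then false :: boolPair [] (boolPair [true] (encList [encodeNat (ws.getD 0 0 + 4)]))
      else if sym = [true] then false :: boolPair [true] (boolPair [true, true, true]
        (encList [[], [true], encodeNat (ws.getD 0 0 + 4)]))
      else if sym = [false, true] then false :: boolPair [true] (boolPair [true, true, true]
        (encList [[], encodeNat (ws.getD 0 0 + 4), encodeNat (ws.getD 1 0 + 4)]))
      else false :: boolPair [true] (boolPair [true, true, true]
        (encList [encodeNat (ws.getD 0 0 + 4), encodeNat (ws.getD 1 0 + 4), encodeNat (ws.getD 2 0 + 4)])) := by
  set a := tag :: boolPair sym (boolPair un (encList (ws.map encodeNat))) with ha'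
  set z := boolPair x (boolPair (encList (a :: l)) acc) with hz
  have hitem : InvCode.itemF z = a := by
    simp only [InvCode.itemF, Function.comp_apply, fanoutFn_apply, hz, nthF_zero_boolPair, nthF_succ_boolPair,
      nthF_zero, encList_cons, fstF_boolPair, takeFn_boolPair]
    exact List.take_of_length_le ha
  have hbody : bodyF z = boolPair sym (boolPair un (encList (ws.map encodeNat))) := by
    simp only [bodyF, Function.comp_apply, fanoutFn_apply, hitem, dropFn_boolPair, List.length_singleton, ha',
      List.drop_succ_cons, List.drop_zero]
  have hsym : InvCode.symF z = sym := by
    have : InvCode.symF z = fstF (bodyF z) := rfl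
    rw [this, hbody, fstF_boolPair]
  have hwires : wiresF z = encList (ws.map encodeNat) := by
    simp only [wiresF, Function.comp_apply, hbody, sndF_boolPair]
  have hsh : ∀ i, shF i z = encodeNat (ws.getD i 0 + 4) := fun i => by
    simp only [shF, Function.comp_apply, fanoutFn_apply, hwires, addFn_boolPair, bitsToNat_nthF_encList_map,
      bitsToNat_encodeNat]
  have htest : ∀ v, isSymF v z = [decide (sym = v)] := fun v => by
    simp only [isSymF, Function.comp_apply, fanoutFn_apply, hsym, eqPairFn_boolPair]
  rw [tauF, iteFn_of_oneBit (oneBit_isSymF _), htest]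
  by_cases h0 : sym = []
  · rw [if_pos (by simp [h0]), if_pos h0]
    simp only [outH, Function.comp_apply, fanoutFn_apply, hsh]
    rfl
  · rw [if_neg (by simp [h0]), if_neg h0, iteFn_of_oneBit (oneBit_isSymF _), htest]
    by_cases h1 : sym = [true]
    · rw [if_pos (by simp [h1]), if_pos h1]
      simp only [outZ, Function.comp_apply, fanoutFn_apply, hsh]
      rfl
    · rw [if_neg (by simp [h1]), if_neg h1, iteFn_of_oneBit (oneBit_isSymF _), htest]
      by_cases h2 : sym = [false, true]
      · rw [if_pos (by simp [h2]), if_pos h2]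
        simp only [outCZ, Function.comp_apply, fanoutFn_apply, hsh]
        rfl
      · rw [if_neg (by simp [h2]), if_neg h2]
        simp only [outCCZ, Function.comp_apply, fanoutFn_apply, hsh]
        rfl

/-- **The code of a proper gate and of its lift**, in the shape of `tauF_record`. [folklore] -/
theorem encode_gate_and_lift (g : hSign.Op) (e : Fin (hSign.arity g) ↪ Fin n) :
    ∃ (sym un : List Bool) (ws : List ℕ),
      (QGate.gate g e : QGate hSign n).encode = false :: boolPair sym (boolPair un (encList (ws.map encodeNat))) ∧
      (liftGate (QGate.gate g e : QGate hSign n)).encode =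
        (if sym = [] then false :: boolPair [] (boolPair [true] (encList [encodeNat (ws.getD 0 0 + 4)]))
        else if sym = [true] then false :: boolPair [true] (boolPair [true, true, true]
          (encList [[], [true], encodeNat (ws.getD 0 0 + 4)]))
        else if sym = [false, true] then false :: boolPair [true] (boolPair [true, true, true]
          (encList [[], encodeNat (ws.getD 0 0 + 4), encodeNat (ws.getD 1 0 + 4)]))
        else false :: boolPair [true] (boolPair [true, true, true]
          (encList [encodeNat (ws.getD 0 0 + 4), encodeNat (ws.getD 1 0 + 4), encodeNat (ws.getD 2 0 + 4)]))) := by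
  rcases g with _ | _ | _ | _
  · exact ⟨[], [true], [(signPlacementH e 0 : ℕ)], encode_sign_H e, by rw [if_pos rfl, encode_liftGate_H]; rfl⟩
  · exact ⟨[true], [true], [(signPlacementZ e 0 : ℕ)], encode_sign_Z e,
      by rw [if_neg (by decide), if_pos rfl, encode_liftGate_Z]; rfl⟩
  · exact ⟨[false, true], [true, true], [(signPlacementCZ e 0 : ℕ), (signPlacementCZ e 1 : ℕ)], encode_sign_CZ e,
      by rw [if_neg (by decide), if_neg (by decide), if_pos rfl, encode_liftGate_CZ]; rfl⟩
  · exact ⟨[true, true], [true, true, true],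
      [(signPlacementCCZ e 0 : ℕ), (signPlacementCCZ e 1 : ℕ), (signPlacementCCZ e 2 : ℕ)], encode_sign_CCZ e,
      by rw [if_neg (by decide), if_neg (by decide), if_neg (by decide), encode_liftGate_CCZ]; rfl⟩

/-- **The round on a proper gate code**: it is popped and the code of the lifted gate is appended.
[folklore] -/
theorem roundF_cons (x acc : List Bool) (g : hSign.Op) (e : Fin (hSign.arity g) ↪ Fin n) (l : List (List Bool))
    (ha : (QGate.gate g e : QGate hSign n).encode.length ≤ x.length) :
    roundF (boolPair x (boolPair (encList ((QGate.gate g e : QGate hSign n).encode :: l)) acc)) =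
      boolPair x (boolPair (encList l) (acc ++ boolPair (liftGate (QGate.gate g e : QGate hSign n)).encode [])) := by
  obtain ⟨sym, un, ws, hcode, hlift⟩ := encode_gate_and_lift g e
  rw [hcode] at ha ⊢
  rw [hlift, ← tauF_record x acc un sym false ws l ha]
  set z := boolPair x (boolPair (encList ((false :: boolPair sym (boolPair un (encList (ws.map encodeNat)))) :: l)) acc)
    with hz
  have hrest : nthF 1 z = boolPair (false :: boolPair sym (boolPair un (encList (ws.map encodeNat)))) (encList l) := by
    simp [hz, encList_cons]
  have hnil : (isNilFn ∘ nthF 1) z = [false] := by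
    rw [Function.comp_apply, hrest]
    simp [isNilFn, boolPair]
  have hx : nthF 0 z = x := by simp [hz]
  have hrest' : (sndF ∘ nthF 1) z = encList l := by rw [Function.comp_apply, hrest, sndF_boolPair]
  have hacc : sndPow 1 z = acc := by simp [hz]
  rw [roundF_apply, if_neg (by rw [hnil]; decide), fanoutFn_apply, fanoutFn_apply, hx, hrest', newAccF, hacc,
    fanoutFn_apply]

/-- The round idles on an empty remaining list. [folklore] -/
theorem roundF_nil (x acc : List Bool) : roundF (boolPair x (boolPair [] acc)) = boolPair x (boolPair [] acc) := by
  have hnil : (isNilFn ∘ nthF 1) (boolPair x (boolPair [] acc)) = [true] := by simp [isNilFn]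
  rw [roundF_apply, if_pos hnil]
  simp

/-- Concatenation of pair lists (twin of `Boards.encList_append`, `ArthurMerlinBoards.lean`, which is not
imported here). [folklore] -/
theorem encList_append (l₁ l₂ : List (List Bool)) : encList (l₁ ++ l₂) = encList l₁ ++ encList l₂ := by
  rw [Com.encList_eq_flatMap, Com.encList_eq_flatMap, Com.encList_eq_flatMap, List.flatMap_append]

/-- A one-item pair list. [folklore] -/
theorem encList_singleton (a : List Bool) : encList [a] = boolPair a [] := rfl

/-- **The rounds on the pair list of the codes of an oracle-free gate list**: with at least as many
rounds as codes, all fitting the input field, the remaining list is emptied and the accumulator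
holds the codes of the lifted gates. [folklore] -/
theorem iterate_roundF (x : List Bool) : ∀ (gs : List (QGate hSign n)) (L : List (List Bool)) (m : ℕ),
    (∀ g ∈ gs, g.IsOracleFree) → gs.length ≤ m → (∀ g ∈ gs, g.encode.length ≤ x.length) →
    roundF^[m] (boolPair x (boolPair (encList (gs.map QGate.encode)) (encList L))) =
      boolPair x (boolPair [] (encList (L ++ gs.map fun g => (liftGate g).encode)))
  | [], L, m, _, _, _ => by
    rw [List.map_nil, List.map_nil, encList_nil, List.append_nil]
    exact Function.iterate_fixed (roundF_nil x _) m
  | g :: gs, L, 0, _, h, _ => by simp at h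
  | g :: gs, L, m + 1, hof, h, hfit => by
    have hg : g.IsOracleFree := hof g (by simp)
    rcases g with ⟨g, e⟩ | ⟨k, e⟩
    · rw [Function.iterate_succ_apply, List.map_cons, roundF_cons x _ g e _ (hfit _ (by simp)),
        ← encList_singleton, ← encList_append,
        iterate_roundF x gs _ m (fun g' hg' => hof g' (by simp [hg'])) (by simpa using h)
          (fun g' hg' => hfit g' (by simp [hg'])), List.map_cons, List.append_assoc]
      rfl
    · exact absurd hg id

/-- Codes in a pair list are shorter than the list. [folklore] -/
theorem length_encode_le_of_mem {gs : List (QGate hSign n)} {g : QGate hSign n} (h : g ∈ gs) :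
    g.encode.length ≤ (encList (gs.map QGate.encode)).length :=
  InvCode.length_le_of_mem_encList (List.mem_map_of_mem h)

/-- **`liftItemsFn` on the code list of an oracle-free gate list is the code list of the lifted gates.**
[folklore] -/
theorem liftItemsFn_encList {gs : List (QGate hSign n)} (hgs : ∀ g ∈ gs, g.IsOracleFree) :
    liftItemsFn (encList (gs.map QGate.encode)) = encList (gs.map fun g => (liftGate g).encode) := by
  have hinit : InvCode.initF (encList (gs.map QGate.encode)) =
      boolPair (encList (gs.map QGate.encode)) (boolPair (encList (gs.map QGate.encode)) (encList [])) := by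
    simp [InvCode.initF, fanoutFn_apply]
  simp only [liftItemsFn, Function.comp_apply, hinit, boolUnpair_boolPair, eval_X]
  rw [iterate_roundF _ gs [] _ hgs ((List.length_map _).symm.le.trans (Com.length_le_length_encList _))
    (fun g hg => length_encode_le_of_mem hg), List.nil_append]
  simp

/-! ### The code of the lifted circuit -/

/-- Transporting a gate to the front wires does not change its code (wire values are kept). [folklore] -/
theorem encode_mapWiresGate_castAddEmb {m : ℕ} (g : QGate hCCSign 4) :
    (mapWiresGate (Fin.castAddEmb m) g).encode = g.encode := by
  rcases g with ⟨g, e⟩ | ⟨k, e⟩ <;> rfl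

/-- The codes of the preparation gates are `prepCodes`. [folklore] -/
theorem map_encode_prepGates : (prepGates n).map QGate.encode = prepCodes := by
  simp only [prepGates, prepCodes, List.map_map]
  exact List.map_congr_left fun g _ => encode_mapWiresGate_castAddEmb g

/-- **The code of the lifted circuit.** [cite: AroraBarak2009, §6.1] -/
theorem encode_liftCircuit (Q : QCircuit hSign n) :
    (liftCircuit Q).encode =
      encList prepCodes ++ (encList (Q.gates.map fun g => (liftGate g).encode) ++ encList prepCodes.reverse) := by
  rw [QCircuit.encode_eq_encList, liftCircuit, liftGates, List.map_append, List.map_append, encList_append,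
    encList_append, List.map_reverse, map_encode_prepGates, List.map_map, List.append_assoc]
  rfl

/-- **The code map on the code of an oracle-free instance is the code of the lifted instance.**
[cite: AaronsonAmbainis2018, §6 (p. 26)] -/
theorem liftCodeFn_encode {I : QSimSignInstance} (hI : I.circuit.IsOracleFree) :
    liftCodeFn I.encode = (liftInstance I).encode := by
  obtain ⟨n, Q⟩ := I
  have hlen : (unaryEncodeNat n).length = n := QSimSignInstance.length_unaryEncodeNat_eq n
  have h1 : (addFn ∘ fanoutFn (lenBinF ∘ fstF) fun _ => encodeNat 4) (boolPair (unaryEncodeNat n) Q.encode) =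
      encodeNat (4 + n) := by
    simp only [Function.comp_apply, fanoutFn_apply, fstF_boolPair, lenBinF_apply, addFn_boolPair, bitsToNat_encodeNat,
      hlen, Nat.add_comm n 4]
  have h2 : encList prepCodes ++ (liftItemsFn (sndF (boolPair (unaryEncodeNat n) Q.encode)) ++ encList prepCodes.reverse) =
      (liftCircuit Q).encode := by
    rw [sndF_boolPair, QCircuit.encode_eq_encList Q, liftItemsFn_encList hI, encode_liftCircuit]
  show fanoutFn _ _ (boolPair (unaryEncodeNat n) Q.encode) = boolPair (encodeNat (4 + n)) (liftCircuit Q).encode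
  rw [fanoutFn_apply, h1, h2]

end CodeMap

end QSimLift

/-! ### The reduction, and Lemma 24 (hardness half) over `{H, CCSIGN}` from the sign basis -/

/-- **QSIM over the sign basis `{H, Z, CZ, CCZ}` Karp-reduces in polynomial time to QSIM over
`{H, CCSIGN}`** (the literal problem of AA Lemma 24), by the exact lift `QSimLift.liftCodeFn`:
amplitudes are preserved (`QSimLift.transitionAmplitude_liftCircuit`), so yes- and no-instances are
mapped to yes- and no-instances with the same thresholds. [cite: AaronsonAmbainis2018, §6 Lemma 24 (p. 26)] -/
theorem qSimSign_polyTimeReducible_qSim : PromiseProblem.PolyTimeReducible qSimSignProblem qSimProblem := by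
  refine ⟨QSimLift.liftCodeFn, QSimLift.liftCodeFn_mem_FP, ?_, ?_⟩
  · rintro w ⟨I, hI, rfl⟩
    rw [QSimLift.liftCodeFn_encode hI.1]
    exact (encode_mem_qSimProblem_yes_iff _).2 (QSimLift.isYes_liftInstance hI)
  · rintro w ⟨I, hI, rfl⟩
    rw [QSimLift.liftCodeFn_encode hI.1]
    exact (encode_mem_qSimProblem_no_iff _).2 (QSimLift.isNo_liftInstance hI)

/-- **AA Lemma 24, hardness half, over `{H, CCSIGN}` from the sign basis**: `PromiseBQP`-hardness of
QSIM over `{H, Z, CZ, CCZ}` (`AaronsonAmbainis2018_lemma24_sign_hard`) gives `PromiseBQP`-hardness of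
QSIM over `{H, CCSIGN}` (`AaronsonAmbainis2018_lemma24_hard`), by composing with the exact reduction
`qSimSign_polyTimeReducible_qSim` (transitivity `PolyTimeReducible.trans_holds`).
[cite: AaronsonAmbainis2018, §6 Lemma 24 (p. 26)] -/
theorem AaronsonAmbainis2018_lemma24_hard_of_sign_hard (h : AaronsonAmbainis2018_lemma24_sign_hard) :
    AaronsonAmbainis2018_lemma24_hard := fun Q hQ =>
  PromiseProblem.PolyTimeReducible.trans_holds (h Q hQ) qSimSign_polyTimeReducible_qSim


end Literature.Computability.QuantumComplexity
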